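import Summits.Ventures.DiscreteObjects.Hadamard.PrimeOrderParitySelfConj
import Summits.Ventures.DiscreteObjects.Hadamard.PrimeOrder17to47

/-!
# Hadamard 668 census, family F12 — orbit numbers for the small prime orders 3, 5, 7, 11: Cauchy–Schwarz window AND parity (kernel)

Framing: lottery ticket; floor = certified bounds/negative ranges.

Cell pub-namedobj (venture DiscreteObjects), target (H), hadamard gen 8.  For an automorphism pair `(ρ, τ)` of prime order
`p ∈ {3, 5, 7, 11}` of the 2-(667,333,166) incidence structure (`ρ` moving a point, `|B| = 667`), the number `m` of `τ`-classes
of moved blocks satisfies the Cauchy–Schwarz window of `orbitCount_cs` (negative discriminant outside it, `decide` tables as in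
`PrimeOrder17to47`) AND is EVEN (`two_dvd_card_blockClasses_of_mem`: Lander's parity theorem in the kernel, `167` being
self-conjugate mod each of these primes):
`p = 3`: `150 ≤ m ≤ 222`; `p = 5`: `108 ≤ m ≤ 132`; `p = 7`: `82 ≤ m ≤ 94`; `p = 11`: `m ∈ {56, 58, 60}`
(`orbitCount_3`, `_5`, `_7`, `_11`; for `p = 13` see `orbitStructure_13`: `m = 48` exactly, gen 6).  The census (FAMILY-F12-G5
§7) sharpens `3, 5, 7` further by an exact orbit-row enumeration (two implementations, not kernel): `168 ≤ m`, `112 ≤ m`,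
`84 ≤ m`; for `p = 11` the kernel statement `{56, 58, 60}` IS the census statement.  Ours, not literature; no `sorry`; `decide`
only for the four arithmetic tables.
-/

open Finset BigOperators

namespace Summit.Ventures.DiscreteObjects.Hadamard

section tables

set_option maxRecDepth 200000 in
/-- `p = 3`: negative discriminant for `1 ≤ m ≤ 148` -/
lemma cs3 : ∀ m ∈ Finset.range 149, 1 ≤ m →
    (0 : ℤ) < 4 * (333 ^ 2 - (m : ℤ) * (167 + 166 * 3)) - (666 - (m : ℤ) * 3) ^ 2 := by decide

set_option maxRecDepth 200000 in
/-- `p = 5`: negative discriminant for `1 ≤ m ≤ 106` -/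
lemma cs5 : ∀ m ∈ Finset.range 107, 1 ≤ m →
    (0 : ℤ) < 4 * (333 ^ 2 - (m : ℤ) * (167 + 166 * 5)) - (666 - (m : ℤ) * 5) ^ 2 := by decide

set_option maxRecDepth 100000 in
/-- `p = 7`: negative discriminant for `1 ≤ m ≤ 81` -/
lemma cs7 : ∀ m ∈ Finset.range 82, 1 ≤ m →
    (0 : ℤ) < 4 * (333 ^ 2 - (m : ℤ) * (167 + 166 * 7)) - (666 - (m : ℤ) * 7) ^ 2 := by decide

set_option maxRecDepth 100000 in
/-- `p = 11`: negative discriminant for `1 ≤ m ≤ 55` -/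
lemma cs11 : ∀ m ∈ Finset.range 56, 1 ≤ m →
    (0 : ℤ) < 4 * (333 ^ 2 - (m : ℤ) * (167 + 166 * 11)) - (666 - (m : ℤ) * 11) ^ 2 := by decide

end tables

section small
variable {P B : Type*} [Fintype P] [DecidableEq P] [Fintype B] [DecidableEq B]

/-- the common skeleton: lower bound from a negative-discriminant table below `m₀`, upper bound from `m p ≤ |B| = 667` -/
lemma orbitCount_window (N : P → B → ℤ) (h01 : ∀ x y, N x y = 0 ∨ N x y = 1)
    (hrow : ∀ x, ∑ y, N x y = 333) (hpair : ∀ x x', x ≠ x' → ∑ y, N x y * N x' y = 166)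
    (hB : Fintype.card B = 667) {p : ℕ} (hp : p.Prime) (m₀ : ℕ)
    (htab : ∀ m ∈ Finset.range m₀, 1 ≤ m →
      (0 : ℤ) < 4 * (333 ^ 2 - (m : ℤ) * (167 + 166 * (p : ℤ))) - (666 - (m : ℤ) * (p : ℤ)) ^ 2)
    (ρ : Equiv.Perm P) (τ : Equiv.Perm B) (hN : ∀ x y, N (ρ x) (τ y) = N x y)
    (hρ : ρ ^ p = 1) (hτ : τ ^ p = 1) (x₀ : P) (hx₀ : ρ x₀ ≠ x₀) :
    m₀ ≤ (blockClasses τ p).card ∧ (blockClasses τ p).card * p ≤ 667 := by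
  obtain ⟨hm1, σ, cs⟩ := orbitCount_cs N h01 hrow hpair p hp ρ τ hN hρ hτ x₀ hx₀
  have hcnt := card_fixed_add_classes τ hp hτ
  rw [hB] at hcnt
  refine ⟨?_, by omega⟩
  by_contra hlt
  exact cs_contra _ _ σ cs (htab _ (Finset.mem_range.mpr (by omega)) hm1)

/-- **`p = 3`**: `150 ≤ m ≤ 222`, `m` even -/
theorem orbitCount_3 (N : P → B → ℤ) (h01 : ∀ x y, N x y = 0 ∨ N x y = 1)
    (hrow : ∀ x, ∑ y, N x y = 333) (hpair : ∀ x x', x ≠ x' → ∑ y, N x y * N x' y = 166)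
    (hcol : ∀ y, ∑ x, N x y = 333) (hcpair : ∀ y y', y ≠ y' → ∑ x, N x y * N x y' = 166)
    (hB : Fintype.card B = 667)
    (ρ : Equiv.Perm P) (τ : Equiv.Perm B) (hN : ∀ x y, N (ρ x) (τ y) = N x y)
    (hρ : ρ ^ 3 = 1) (hτ : τ ^ 3 = 1) (x₀ : P) (hx₀ : ρ x₀ ≠ x₀) :
    150 ≤ (blockClasses τ 3).card ∧ (blockClasses τ 3).card ≤ 222 ∧ 2 ∣ (blockClasses τ 3).card := by
  have h2 := two_dvd_card_blockClasses_of_mem N h01 hrow hpair hcol hcpair (Or.inr (Or.inl rfl)) ρ τ hN hρ hτ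
  obtain ⟨hlo, hhi⟩ := orbitCount_window N h01 hrow hpair hB (by norm_num) 149 (by exact_mod_cast cs3) ρ τ hN hρ hτ x₀ hx₀
  omega

/-- **`p = 5`**: `108 ≤ m ≤ 132`, `m` even -/
theorem orbitCount_5 (N : P → B → ℤ) (h01 : ∀ x y, N x y = 0 ∨ N x y = 1)
    (hrow : ∀ x, ∑ y, N x y = 333) (hpair : ∀ x x', x ≠ x' → ∑ y, N x y * N x' y = 166)
    (hcol : ∀ y, ∑ x, N x y = 333) (hcpair : ∀ y y', y ≠ y' → ∑ x, N x y * N x y' = 166)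
    (hB : Fintype.card B = 667)
    (ρ : Equiv.Perm P) (τ : Equiv.Perm B) (hN : ∀ x y, N (ρ x) (τ y) = N x y)
    (hρ : ρ ^ 5 = 1) (hτ : τ ^ 5 = 1) (x₀ : P) (hx₀ : ρ x₀ ≠ x₀) :
    108 ≤ (blockClasses τ 5).card ∧ (blockClasses τ 5).card ≤ 132 ∧ 2 ∣ (blockClasses τ 5).card := by
  have h2 := two_dvd_card_blockClasses_of_mem N h01 hrow hpair hcol hcpair (Or.inr (Or.inr (Or.inl rfl))) ρ τ hN hρ hτ
  obtain ⟨hlo, hhi⟩ := orbitCount_window N h01 hrow hpair hB (by norm_num) 107 (by exact_mod_cast cs5) ρ τ hN hρ hτ x₀ hx₀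
  omega

/-- **`p = 7`**: `82 ≤ m ≤ 94`, `m` even -/
theorem orbitCount_7 (N : P → B → ℤ) (h01 : ∀ x y, N x y = 0 ∨ N x y = 1)
    (hrow : ∀ x, ∑ y, N x y = 333) (hpair : ∀ x x', x ≠ x' → ∑ y, N x y * N x' y = 166)
    (hcol : ∀ y, ∑ x, N x y = 333) (hcpair : ∀ y y', y ≠ y' → ∑ x, N x y * N x y' = 166)
    (hB : Fintype.card B = 667)
    (ρ : Equiv.Perm P) (τ : Equiv.Perm B) (hN : ∀ x y, N (ρ x) (τ y) = N x y)
    (hρ : ρ ^ 7 = 1) (hτ : τ ^ 7 = 1) (x₀ : P) (hx₀ : ρ x₀ ≠ x₀) :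
    82 ≤ (blockClasses τ 7).card ∧ (blockClasses τ 7).card ≤ 94 ∧ 2 ∣ (blockClasses τ 7).card := by
  have h2 := two_dvd_card_blockClasses_of_mem N h01 hrow hpair hcol hcpair (Or.inr (Or.inr (Or.inr (Or.inl rfl)))) ρ τ hN hρ hτ
  obtain ⟨hlo, hhi⟩ := orbitCount_window N h01 hrow hpair hB (by norm_num) 82 (by exact_mod_cast cs7) ρ τ hN hρ hτ x₀ hx₀
  omega

/-- **`p = 11`**: `m ∈ {56, 58, 60}` -/
theorem orbitCount_11 (N : P → B → ℤ) (h01 : ∀ x y, N x y = 0 ∨ N x y = 1)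
    (hrow : ∀ x, ∑ y, N x y = 333) (hpair : ∀ x x', x ≠ x' → ∑ y, N x y * N x' y = 166)
    (hcol : ∀ y, ∑ x, N x y = 333) (hcpair : ∀ y y', y ≠ y' → ∑ x, N x y * N x y' = 166)
    (hB : Fintype.card B = 667)
    (ρ : Equiv.Perm P) (τ : Equiv.Perm B) (hN : ∀ x y, N (ρ x) (τ y) = N x y)
    (hρ : ρ ^ 11 = 1) (hτ : τ ^ 11 = 1) (x₀ : P) (hx₀ : ρ x₀ ≠ x₀) :
    (blockClasses τ 11).card = 56 ∨ (blockClasses τ 11).card = 58 ∨ (blockClasses τ 11).card = 60 := by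
  have h2 := two_dvd_card_blockClasses_of_mem N h01 hrow hpair hcol hcpair
    (Or.inr (Or.inr (Or.inr (Or.inr (Or.inl rfl))))) ρ τ hN hρ hτ
  obtain ⟨hlo, hhi⟩ := orbitCount_window N h01 hrow hpair hB (by norm_num) 56 (by exact_mod_cast cs11) ρ τ hN hρ hτ x₀ hx₀
  omega

end small

end Summit.Ventures.DiscreteObjects.Hadamard
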